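import Summits.FinalStateConjecture.FinalStateConjecture.Theorems.EIHFluxBalanceInertialRecessionAnsatzDecay
import Summits.FinalStateConjecture.FinalStateConjecture.Theorems.EIHFluxBalanceInertialRecessionChartCalculus

/-!
# Route EIHFluxBalance — `InertialRecession`: the flat (radiation-zone) chart on hole-following domains

Helper file for the crux `stmt-FinalStateConjecture-10166`
(`Summit.FinalStateConjecture.FinalStateConjecture.Theses.EIHFluxBalance.InertialRecession`).

The conclusion of `InertialRecession` asks for a `FinalStateDecomposition`, whose flat chart
must converge to `η` in `Cᵏ` on WHOLE slabs of its domain. Given the crux hypothesis — one lab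
chart `Φ : U → M` whose `Cᵏ` deviation from the modulated multi-Kerr–Schild reference field
`B = η + Σᵢ (boostedKerrBilin (Λᵢ(x⁰)) (x⁰, ξᵢ(x⁰)) Mᵢ aᵢ − η)` tends to `0` on the lab slabs — the
natural flat chart is `Φ` RESTRICTED to a hole-following far domain `U₀ ≤ U` whose slice at lab
time `t` keeps lab distance `> R′(t) → ∞` from every painted centre `ξᵢ(t)` (card
`cesaro-velocities-suffice`, Cruxes/InertialRecession/Ideas). This file proves that this chart
converges:

  `deviationCk (Minkowski.backgroundOn U₀) (Φ ∘ incl) k t → 0`   (`tendsto_deviationCk_flat_of_ansatz`)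

provided the motions have `k` lab-time derivatives bounded by `Γ` from some time on (frame paths
`s ↦ Λᵢ(s)⁻¹` and centres `ξᵢ`; NO convergence of velocities or boosts is needed — these bounds
are what painting rigidity + re-modulation deliver). Ingredients: the restriction formula
`(Φ|U₀)^*g − η = (Φ^*g − B) + (B − η)` (chain rule along the
inclusion of open sets, whose differential is the identity;
`deviation_backgroundOn_comp_inclusion'` of file `…ChartCalculus`), smoothness of the extended
deviation wherever the reference field is smooth (`contDiffAt_deviationExtend_of_bilin`), and the
`Cᵐ` decay `|Mᵢ| C / ‖x̲ − ξᵢ(t)‖` of each ansatz summand on the slab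
(`exists_norm_iteratedFDeriv_ansatzSummand_le`). Pattern of proof:
`Literature.Geometry.Lorentzian.Spacetime.tendsto_deviationCk_backgroundOn` (the unboosted,
static `N = 1` case).
-/

noncomputable section

open Literature.Geometry.Lorentzian Set Filter Function TopologicalSpace
open scoped ContDiff Topology Manifold ENNReal

namespace Summit.FinalStateConjecture.FinalStateConjecture.Theorems

/-! ### The modulated reference field -/

/-- Each ansatz summand `y ↦ boostedKerrBilin (Λ (y⁰)) (y⁰, ξ(y⁰)) M a y − η` is `Cⁿ` at every
point whose painted rest position is off the ring (`r > 0`), for `Cⁿ` motions (frame path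
`s ↦ Λ(s)⁻¹` and centre `ξ`). Kerr–Schild 1965, §3. [cite: KerrSchild1965, §3] -/
theorem contDiffAt_ansatzSummand {Λ : ℝ → lorentzGroup} {ξ : ℝ → E3} {M a : ℝ} {n : WithTop ℕ∞}
    (hΛ : ContDiff ℝ n (fun s ↦ (((Λ s : E4 ≃L[ℝ] E4).symm : E4 →L[ℝ] E4)))) (hξ : ContDiff ℝ n ξ)
    {x : E4} (hx : 0 < Kerr.radius a ((((Λ (x 0) : E4 ≃L[ℝ] E4).symm : E4 →L[ℝ] E4))
      (x - E4.ofTimeSpace (x 0) (ξ (x 0))))) :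
    ContDiffAt ℝ n (fun y : E4 ↦ boostedKerrBilin (Λ (y 0)) (E4.ofTimeSpace (y 0) (ξ (y 0)))
      M a y - Minkowski.bilin) x := by
  rw [boostedKerrBilin_sub_eq_bilinearComp]
  have hproj : ContDiff ℝ n (fun y : E4 ↦ y 0) :=
    (EuclideanSpace.proj (0 : Fin 4) : E4 →L[ℝ] ℝ).contDiff
  have hcc : ContDiff ℝ n (fun s ↦ E4.ofTimeSpace s (ξ s)) := by
    have hsplit : (fun s ↦ E4.ofTimeSpace s (ξ s)) =
        fun s : ℝ ↦ s • E4.basisVector 0 + E4.spaceEmbed (ξ s) :=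
      funext fun s ↦ E4.ofTimeSpace_eq_smul_add' s (ξ s)
    rw [hsplit]
    exact (contDiff_id.smul contDiff_const).add (E4.spaceEmbed.contDiff.comp hξ)
  have hΘ : ContDiff ℝ n (fun y : E4 ↦ (((Λ (y 0) : E4 ≃L[ℝ] E4).symm : E4 →L[ℝ] E4))) :=
    hΛ.comp hproj
  have hφ : ContDiff ℝ n (fun y : E4 ↦ (((Λ (y 0) : E4 ≃L[ℝ] E4).symm : E4 →L[ℝ] E4))
      (y - E4.ofTimeSpace (y 0) (ξ (y 0)))) :=
    hΘ.clm_apply (contDiff_id.sub (hcc.comp hproj))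
  have hP : ContDiffAt ℝ n (fun y : E4 ↦ Kerr.bilin M a ((((Λ (y 0) : E4 ≃L[ℝ] E4).symm :
      E4 →L[ℝ] E4)) (y - E4.ofTimeSpace (y 0) (ξ (y 0)))) - Minkowski.bilin) x :=
    (Kerr.contDiffAt_ksPert hx).comp x hφ.contDiffAt
  exact (contDiffWithinAt_bilinearComp_self (s := univ) hP.contDiffWithinAt
    hΘ.contDiffAt.contDiffWithinAt).contDiffAt univ_mem

/-- The painted radius in `poincareInv` form is the painted radius in frame-path form (`Λ⁻¹` as
an operator applied to `x − c`; bookkeeping, by `rfl`). [folklore] -/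
theorem radius_poincareInv_eq (Λ : lorentzGroup) (c x : E4) (a : ℝ) :
    Kerr.radius a (poincareInv Λ c x) =
      Kerr.radius a ((((Λ : E4 ≃L[ℝ] E4).symm : E4 →L[ℝ] E4)) (x - c)) := rfl

-- operator-norm instance paths on form-valued multilinear maps are slow to unify
set_option synthInstance.maxHeartbeats 200000 in
/-- **The flat chart on a hole-following far domain converges to Minkowski space.** Let `Φ : U → M`
be a smooth chart map whose `Cᵏ` deviation from the modulated multi-Kerr–Schild reference field
`B = η + Σᵢ (boostedKerrBilin (Λᵢ(x⁰)) (x⁰, ξᵢ(x⁰)) Mᵢ aᵢ x − η)` on the lab slabs `{x⁰ = t}` tends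
to `0` (the crux hypothesis, any `k`). Assume the motions are smooth with `k` lab-time derivatives
of the frame paths `s ↦ Λᵢ(s)⁻¹` and of the centres `ξᵢ` bounded by `Γ` for `t ≥ T₀`, and let
`U₀ ≤ U` be an open set whose slice at lab time `t` stays at lab distance `> R′(t)` from every
centre `ξᵢ(t)`, with `R′(t) → ∞`. Then the `Cᵏ` deviation of `Φ|U₀` from `η` on the slabs of `U₀`
tends to `0`: `(Φ|U₀)^*g − η = (Φ^*g − B) + Σᵢ (summand i)` and each summand is `O(1/R′(t))` in
`Cᵏ` there (`exists_norm_iteratedFDeriv_ansatzSummand_le`). This is the radiation-zone clause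
`tendsto_deviationCk_flat` of the sought `FinalStateDecomposition` for the flat chart
`Φ ∘ inclusion`. DHRT arXiv:2104.08222, §1 (deviation norms); Kerr–Schild 1965, §3. [folklore] -/
theorem tendsto_deviationCk_flat_of_ansatz' (𝓢 : Spacetime 4) {N : ℕ} (M a : Fin N → ℝ)
    (Λ : Fin N → ℝ → lorentzGroup) (ξ : Fin N → ℝ → E3) (U : Opens E4) (Φ : U → 𝓢.carrier)
    (hΦ : ContMDiff 𝓘(ℝ, E4) (𝓡 4) ∞ Φ) {k : ℕ}
    (hdev : Tendsto (fun t ↦ 𝓢.deviationCk ⟨U, fun x ↦ Minkowski.bilin +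
      ∑ i, (boostedKerrBilin (Λ i (x 0)) (E4.ofTimeSpace (x 0) (ξ i (x 0))) (M i) (a i) x -
        Minkowski.bilin), fun x ↦ x 0, E4.spatialNorm⟩ Φ k t) atTop (𝓝 0))
    (hΛ : ∀ i, ContDiff ℝ ∞ (fun s ↦ (((Λ i s : E4 ≃L[ℝ] E4).symm : E4 →L[ℝ] E4))))
    (hξ : ∀ i, ContDiff ℝ ∞ (ξ i)) {Γ T₀ : ℝ} (hΓ : 1 ≤ Γ)
    (hΛb : ∀ i t, T₀ ≤ t → ∀ j ≤ k,
      ‖iteratedDeriv j (fun s ↦ (((Λ i s : E4 ≃L[ℝ] E4).symm : E4 →L[ℝ] E4))) t‖ ≤ Γ)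
    (hξb : ∀ i t, T₀ ≤ t → ∀ j, 1 ≤ j → j ≤ k → ‖iteratedDeriv j (ξ i) t‖ ≤ Γ)
    {R' : ℝ → ℝ} (hR : Tendsto R' atTop atTop) {U₀ : Opens E4} (hU₀ : U₀ ≤ U)
    (hfar : ∀ z ∈ U₀, ∀ i, R' (z 0) < ‖E4.spatial z - ξ i (z 0)‖) :
    Tendsto (fun t ↦ 𝓢.deviationCk (Minkowski.backgroundOn U₀) (Φ ∘ Opens.inclusion hU₀) k t)
      atTop (𝓝 0) := by
  set B : ModelBackground := ⟨U, fun x ↦ Minkowski.bilin +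
      ∑ i, (boostedKerrBilin (Λ i (x 0)) (E4.ofTimeSpace (x 0) (ξ i (x 0))) (M i) (a i) x -
        Minkowski.bilin), fun x ↦ x 0, E4.spatialNorm⟩ with hB
  have hdom : (Minkowski.backgroundOn U₀).domain ≤ B.domain := hU₀
  -- decay constants for the orders `m ≤ k`
  have hdec := fun m : ℕ ↦ exists_norm_iteratedFDeriv_ansatzSummand_le' m hΓ
  choose C hC0 hC using hdec
  set Cmax : ℝ := ∑ m ∈ Finset.range (k + 1), C m with hCmax
  have hCm : ∀ m ≤ k, C m ≤ Cmax := fun m hm ↦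
    Finset.single_le_sum (f := C) (fun m _ ↦ hC0 m)
      (Finset.mem_range.mpr (Nat.lt_succ_of_le hm))
  have hCmax0 : 0 ≤ Cmax := Finset.sum_nonneg fun m _ ↦ hC0 m
  set Mtot : ℝ := ∑ i, |M i| with hMtot
  set A₀ : ℝ := max 1 (2 * ∑ i, |a i|) with hA₀
  have hA₀1 : 1 ≤ A₀ := le_max_left _ _
  have hA₀i : ∀ i, max 1 (2 * |a i|) ≤ A₀ := fun i ↦ by
    refine max_le (le_max_left _ _) ((mul_le_mul_of_nonneg_left ?_ zero_le_two).trans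
      (le_max_right _ _))
    exact Finset.single_le_sum (f := fun i ↦ |a i|) (fun _ _ ↦ abs_nonneg _) (Finset.mem_univ i)
  -- the summands
  have hsum : ∀ y : E4, B.bilin y - Minkowski.bilin = ∑ i,
      (boostedKerrBilin (Λ i (y 0)) (E4.ofTimeSpace (y 0) (ξ i (y 0))) (M i) (a i) y -
        Minkowski.bilin) := fun y ↦ by
    simp only [hB]
    exact add_sub_cancel_left Minkowski.bilin _
  -- pointwise bound on late, far slabs
  have hbound : ∀ t, T₀ ≤ t → A₀ ≤ R' t →
      𝓢.deviationCk (Minkowski.backgroundOn U₀) (Φ ∘ Opens.inclusion hU₀) k t ≤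
        𝓢.deviationCk B Φ k t + ENNReal.ofReal (Mtot * Cmax / R' t) := by
    intro t ht hRt
    have hR0 : 0 < R' t := one_pos.trans_le (hA₀1.trans hRt)
    refine iSup₂_le fun m hm ↦ iSup₂_le fun z hz ↦ ?_
    obtain ⟨x, hx, rfl⟩ := hz
    have hxU₀ : (x : E4) ∈ U₀ := x.2
    have hx0 : (x : E4) 0 = t := hx
    have hdist : ∀ i, R' t < ‖E4.spatial (x : E4) - ξ i t‖ := fun i ↦ by
      have h := hfar x hxU₀ i
      rwa [hx0] at h
    have hdi : ∀ i, max 1 (2 * |a i|) ≤ ‖E4.spatial (x : E4) - ξ i t‖ := fun i ↦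
      ((hA₀i i).trans hRt).trans (hdist i).le
    -- positivity of the painted radii at `x`
    have hrad : ∀ i, 0 < Kerr.radius (a i) ((((Λ i ((x : E4) 0) : E4 ≃L[ℝ] E4).symm :
        E4 →L[ℝ] E4)) ((x : E4) - E4.ofTimeSpace ((x : E4) 0) (ξ i ((x : E4) 0)))) := by
      intro i
      rw [← radius_poincareInv_eq, hx0]
      have h1 := sq_sub_sq_le_radius_poincareInv_sq (Λ i t) (a i) t (ξ i t) hx0
      have h2 : 1 ≤ ‖E4.spatial (x : E4) - ξ i t‖ := (le_max_left _ _).trans (hdi i)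
      have h3 : 2 * |a i| ≤ ‖E4.spatial (x : E4) - ξ i t‖ := (le_max_right _ _).trans (hdi i)
      have h4 : 0 < ‖E4.spatial (x : E4) - ξ i t‖ ^ 2 - a i ^ 2 := by
        nlinarith [abs_nonneg (a i), sq_abs (a i)]
      have h5 := Kerr.radius_nonneg (a i) (poincareInv (Λ i t) (E4.ofTimeSpace t (ξ i t)) x)
      nlinarith
    -- smoothness at `x`
    have hSi' : ∀ i, ContDiffAt ℝ ∞ (fun y : E4 ↦ boostedKerrBilin (Λ i (y 0))
        (E4.ofTimeSpace (y 0) (ξ i (y 0))) (M i) (a i) y - Minkowski.bilin) x := fun i ↦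
      contDiffAt_ansatzSummand (hΛ i) (hξ i) (hrad i)
    have hSi : ∀ i, ContDiffAt ℝ m (fun y : E4 ↦ boostedKerrBilin (Λ i (y 0))
        (E4.ofTimeSpace (y 0) (ξ i (y 0))) (M i) (a i) y - Minkowski.bilin) x := fun i ↦
      (hSi' i).of_le (by exact_mod_cast le_top)
    have hb' : ContDiffAt ℝ ∞ B.bilin x := by
      change ContDiffAt ℝ ∞ (fun y ↦ Minkowski.bilin + ∑ i, (boostedKerrBilin (Λ i (y 0))
        (E4.ofTimeSpace (y 0) (ξ i (y 0))) (M i) (a i) y - Minkowski.bilin)) x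
      exact contDiffAt_const.add (ContDiffAt.sum fun i _ ↦ hSi' i)
    have hb : ContDiffAt ℝ m B.bilin x := hb'.of_le (by exact_mod_cast le_top)
    have h1 : ContDiffAt ℝ m (𝓢.deviationExtend B Φ) x :=
      (contDiffAt_deviationExtend_of_bilin 𝓢 B hΦ (Opens.inclusion hdom x) hb').of_le
        (by exact_mod_cast le_top)
    have h2 : ContDiffAt ℝ m (fun y ↦ B.bilin y - Minkowski.bilin) x := hb.sub contDiffAt_const
    have hev := deviationExtend_backgroundOn_eventuallyEq' 𝓢 B hdom hΦ hxU₀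
    rw [(hev.iteratedFDeriv ℝ m).eq_of_nhds]
    change ‖iteratedFDeriv ℝ m (𝓢.deviationExtend B Φ + fun y ↦ B.bilin y - Minkowski.bilin) x‖ₑ
      ≤ _
    have hmem : (x : E4) ∈ Subtype.val '' B.timeSlab t := ⟨Opens.inclusion hdom x, hx0, rfl⟩
    refine (enorm_iteratedFDeriv_add_le h1 h2).trans (add_le_add ?_ ?_)
    · exact enorm_iteratedFDeriv_le_supCkENorm hm hmem _
    · refine enorm_le_ofReal_of_norm_le ?_
      have hfun : (fun y ↦ B.bilin y - Minkowski.bilin) = fun y ↦ ∑ i,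
          (boostedKerrBilin (Λ i (y 0)) (E4.ofTimeSpace (y 0) (ξ i (y 0))) (M i) (a i) y -
            Minkowski.bilin) := funext hsum
      rw [hfun, iteratedFDeriv_fun_sum_apply fun i _ ↦ hSi i]
      refine (norm_sum_le _ _).trans ?_
      have hterm : ∀ i, ‖iteratedFDeriv ℝ m (fun y : E4 ↦ boostedKerrBilin (Λ i (y 0))
          (E4.ofTimeSpace (y 0) (ξ i (y 0))) (M i) (a i) y - Minkowski.bilin) x‖ ≤
          |M i| * Cmax / R' t := by
        intro i
        have h := hC m (M i) (a i) (Λ i) (ξ i) t x ((hΛ i).of_le (by exact_mod_cast le_top))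
          ((hξ i).of_le (by exact_mod_cast le_top)) (fun j hj ↦ hΛb i t ht j (hj.trans hm))
          (fun j hj1 hj ↦ hξb i t ht j hj1 (hj.trans hm)) hx0 (hdi i)
        refine h.trans ?_
        calc |M i| * C m / ‖E4.spatial (x : E4) - ξ i t‖ ≤ |M i| * Cmax / ‖E4.spatial (x : E4) -
              ξ i t‖ := by
              gcongr
              exact hCm m hm
          _ ≤ |M i| * Cmax / R' t :=
              div_le_div_of_nonneg_left (by positivity) hR0 (hdist i).le
      calc ∑ i, ‖iteratedFDeriv ℝ m (fun y : E4 ↦ boostedKerrBilin (Λ i (y 0))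
            (E4.ofTimeSpace (y 0) (ξ i (y 0))) (M i) (a i) y - Minkowski.bilin) x‖
          ≤ ∑ i, |M i| * Cmax / R' t := Finset.sum_le_sum fun i _ ↦ hterm i
        _ = Mtot * Cmax / R' t := by rw [hMtot, Finset.sum_mul, Finset.sum_div]
  -- the limit
  have hlim : Tendsto (fun t ↦ 𝓢.deviationCk B Φ k t + ENNReal.ofReal (Mtot * Cmax / R' t))
      atTop (𝓝 0) := by
    have h2 : Tendsto (fun t ↦ Mtot * Cmax / R' t) atTop (𝓝 0) := tendsto_const_nhds.div_atTop hR
    simpa using hdev.add (ENNReal.tendsto_ofReal h2)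
  refine tendsto_of_tendsto_of_tendsto_of_le_of_le' tendsto_const_nhds hlim
    (Eventually.of_forall fun _ ↦ zero_le) ?_
  filter_upwards [hR.eventually_ge_atTop A₀, eventually_ge_atTop T₀] with t hRt ht
  exact hbound t ht hRt


-- operator-norm instance paths on form-valued multilinear maps are slow to unify
set_option synthInstance.maxHeartbeats 200000 in
/-- Registered sub-goal form (stub `tendsto_deviationCk_flat_of_ansatz` of the crux item) of
`tendsto_deviationCk_flat_of_ansatz'`: the flat chart `Φ|U₀` on a hole-following far domain
converges to `η` in `Cᵏ` on whole slabs. DHRT arXiv:2104.08222, §1. [folklore] -/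
theorem tendsto_deviationCk_flat_of_ansatz : open Literature.Geometry.Lorentzian in ∀ (𝓢 : Spacetime 4) {N : ℕ} (M a : Fin N → ℝ) (Λ : Fin N → ℝ → lorentzGroup) (ξ : Fin N → ℝ → E3) (U : Opens E4) (Φ : U → 𝓢.carrier), ContMDiff 𝓘(ℝ, E4) (𝓡 4) ((⊤ : ℕ∞) : WithTop ℕ∞) Φ → ∀ {k : ℕ}, Tendsto (fun t ↦ 𝓢.deviationCk ⟨U, fun x ↦ Minkowski.bilin + ∑ i, (boostedKerrBilin (Λ i (x 0)) (E4.ofTimeSpace (x 0) (ξ i (x 0))) (M i) (a i) x - Minkowski.bilin), fun x ↦ x 0, E4.spatialNorm⟩ Φ k t) atTop (𝓝 0) → (∀ i, ContDiff ℝ ((⊤ : ℕ∞) : WithTop ℕ∞) (fun s ↦ (((Λ i s : E4 ≃L[ℝ] E4).symm : E4 →L[ℝ] E4)))) → (∀ i, ContDiff ℝ ((⊤ : ℕ∞) : WithTop ℕ∞) (ξ i)) → ∀ {Γ T₀ : ℝ}, 1 ≤ Γ → (∀ i t, T₀ ≤ t → ∀ j ≤ k, ‖iteratedDeriv j (fun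 s ↦ (((Λ i s : E4 ≃L[ℝ] E4).symm : E4 →L[ℝ] E4))) t‖ ≤ Γ) → (∀ i t, T₀ ≤ t → ∀ j, 1 ≤ j → j ≤ k → ‖iteratedDeriv j (ξ i) t‖ ≤ Γ) → ∀ {R' : ℝ → ℝ}, Tendsto R' atTop atTop → ∀ {U₀ : Opens E4} (hU₀ : U₀ ≤ U), (∀ z ∈ U₀, ∀ i, R' (z 0) < ‖E4.spatial z - ξ i (z 0)‖) → Tendsto (fun t ↦ 𝓢.deviationCk (Minkowski.backgroundOn U₀) (Φ ∘ Opens.inclusion hU₀) k t) atTop (𝓝 0) :=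
  fun 𝓢 _ M a Λ ξ U Φ hΦ _ hdev hΛ hξ _ _ hΓ hΛb hξb _ hR _ hU₀ hfar ↦
    tendsto_deviationCk_flat_of_ansatz' 𝓢 M a Λ ξ U Φ hΦ hdev hΛ hξ hΓ hΛb hξb hR hU₀ hfar

end Summit.FinalStateConjecture.FinalStateConjecture.Theorems

end
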